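import Summits.RiemannHypothesis.RiemannHypothesis.Theses.SpectralTrace
import Summits.RiemannHypothesis.RiemannHypothesis.Theorems.WindowStep.Negative.Collapse
import Summits.RiemannHypothesis.RiemannHypothesis.Theorems.WindowStep.Negative.LoadBearing
import Summits.RiemannHypothesis.RiemannHypothesis.Theorems.SpectralTraceWindowTraceToPositivity
import Summits.RiemannHypothesis.RiemannHypothesis.Theorems.WeilWindowFlowGronwallLeakageStrictAnti
import Summits.RiemannHypothesis.RiemannHypothesis.Theorems.SpectralTraceWindowStepRungCorridor
import Summits.RiemannHypothesis.RiemannHypothesis.Theorems.WindowTraceArch.Negative.LocalWeyl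
import Summits.RiemannHypothesis.RiemannHypothesis.Theorems.WindowTraceArch.Negative.UnitMass
import Summits.RiemannHypothesis.RiemannHypothesis.Theorems.SpectralTraceWindowStepStubTraceLimit
import Summits.RiemannHypothesis.RiemannHypothesis.Theorems.SpectralTraceWindowStepStubTraceDilate
import Summits.RiemannHypothesis.RiemannHypothesis.Theorems.SpectralTraceWindowStepStubGroundStateSampling
import Summits.RiemannHypothesis.RiemannHypothesis.Theorems.SpectralTraceWindowStepStubGapLemma
import Summits.RiemannHypothesis.RiemannHypothesis.Theorems.SpectralTraceWindowStepCoagulationLittleO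
import Summits.RiemannHypothesis.RiemannHypothesis.Theorems.SpectralTraceWindowStepFirstRungRegular
import Summits.RiemannHypothesis.RiemannHypothesis.Theorems.SpectralTraceWindowStepSharpMultiplicityCap
import Summits.RiemannHypothesis.RiemannHypothesis.Theorems.SpectralTraceWindowStepSaturatedAtoms
import Literature.NumberTheory.LFunctions.WeilWindowSuzukiContinuityProofs
import Literature.NumberTheory.LFunctions.WeilGroundState
import Literature.NumberTheory.LFunctions.WeilGroundEnergyProofs
import Literature.NumberTheory.LFunctions.WeilSemilocalCompactnessProofs
import Literature.NumberTheory.LFunctions.WeilFirstPrimePositivityC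
import HarnessLib

/-!
# Line `conjugate-point` for the crux `WindowStep` (stmt-RiemannHypothesis-14659)
# — the CONJUGATE-POINT DICHOTOMY of the window ladder (crux-strategist, wall-breaker, 2026-08-17)

LEAD RESHAPE v5 (lead seat c4, 2026-08-17, after wave 1): the wave-1 worker LANDED two RH-free
structure theorems for the edge horn — p142955 `Theorems/SpectralTraceWindowStepSharpMultiplicityCap`
(`ncard_fibre_le_sharp`: the SHARP Christoffel cap `#{i | γ i = x} ≤ (1/(2a) + η) log|x|` for
`|x| ≥ X(a, η)`, uniform over level-`2a` families; `coagulationDense_of_inv_lt`: the edge stub is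
VACUOUS for every density parameter `δ > 1/(2a)`) and p143295
`Theorems/SpectralTraceWindowStepSaturatedAtoms` (`saturatedAtoms_linear_density`: a violator's
saturated atoms `{x : κ log|x| ≤ #{i | γ i = x}}` have LINEAR density `≥ κ r`;
`coagulation_excluded_or_saturated`). The registered edge stub is therefore NARROWED to its exact
residual `stub_coagulationSaturated` (density parameter `0 < δ ≤ 1/(2a)`), and the v3/v4 statement
`CoagulationDense` is DERIVED (`coagulationDense_of_saturated`: case `δ ≤ 1/(2a)` = the stub, case
`δ > 1/(2a)` = `coagulationDense_of_inv_lt`). First-order counting is now exhausted on BOTH sides at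
the tree's constants: cap slope `1/(2a)` (sharp) against a linear density of log-saturated real zeros
of `û` (non-sharp `κ`; the sharp lower slope needs the Levinson–Cartwright real-zero density
`n_ℝ(r, û) ≤ (2a/π + o(1)) r` for type-`a` transforms bounded on `ℝ`, absent from Mathlib and the
tree — and even then the two slopes balance EXACTLY, so the residual is second-order/Diophantine).
Composition `WindowStep_of` unchanged in shape (2 sorries = the 2 registered stubs
`stub_coagulationSaturated`, `stub_crystRegular`).

LEAD v4 (lead seat c4, 2026-08-17; prepared by c3, published now that the farm has built
`Theorems/SpectralTraceWindowStepFirstRungRegular.lean`, p141362): `0 < ε((log 3)/2)` is a THEOREM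
(`weilGroundEnergy_log_three_half_pos`), so (i) the by-product `windowTracePrime2_of_crystRegular`
is UNCONDITIONAL — the held stub's first contentful instance `B = log 3` is EXACTLY the sibling crux
`WindowTracePrime2` from the seed (`crystRegular_first_instance_iff` below makes this exact:
`CrystRegular` restricted to `B ≤ log 3` ↔ (`WindowTraceArch → WindowTracePrime2`)); (ii) in
`noDegenerateEdge_of` the theorem range is the CLOSED ray `a ≤ (log 3)/2`
(`weilGroundEnergy_pos_of_le_log_three_half`), the edge stub is consumed only for `a > (log 3)/2`
(indeed only for `a ≥ a₁` for some `a₁ > (log 3)/2`, `exists_gt_log_three_half_weilGroundEnergy_pos`).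
Registered stubs and the composition `WindowStep_of` are UNCHANGED (2 sorries = the 2 open stubs).

LEAD RESHAPE v3 (lead seat c3, 2026-08-17, after wave 1): stubs 1a `stub_traceLimit` (p138948),
1b `stub_traceDilate` (p139078), 2 `stub_groundStateSampling` (p138965), 3 `stub_gapLemma` (p139126)
LANDED and are imported below (the local `stub_*` theorems are now one-line references, sorry-free);
the RH-free little-o sub-case of the edge horn LANDED (`coagulation_excluded_of_mult_le_log`,
p139507/p139673/p139806: multiplicities `≤ δ(a)·log|x|` eventually ⇒ not inside `Z_ℝ(û)`, at ANY
level, no `ε(a) = 0` needed), so the edge stub is NARROWED to its exact typed residual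
`stub_coagulationDense` (multiplicities of POSITIVE upper logarithmic density on `Z_ℝ(û)` at a
conjugate point) and `noDegenerateEdge_of` now splits on `∃ X, ∀ |x| ≥ X, mult ≤ δ(a) log|x|`
(little-o lemma) vs its negation (the dense stub); `stub_gapLemma` stays as the landed bounded case
(no longer needed by the composition). Open: `stub_coagulationDense`, `stub_crystRegular` — jointly
`WindowTraceArch → RH` given the landed ones (`riemannHypothesis_of_stubs`).

LEAD RESHAPE v2 (lead seat c3, 2026-08-17): the registered stub `stub_traceClosed` (one XL Lean
statement: selection + identification + closed-endpoint closure) is split at the skeleton level into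
TWO registered stubs of worker size — `stub_traceLimit` (local compactness of rung configurations
along `B_k ↑ A` + identification on the OPEN window: ONE family serving every level `B < A`) and
`stub_traceDilate` (a family serving every level `B < A` serves the CLOSED level `A`: dilation
`g(t/r)`, `r ↑ 1`, continuity of `W` along it, dominated convergence on the family) — and
`TraceClosed` is DERIVED from them (`traceClosed_of`). Stubs now: 6 (≤ 7). Composition unchanged.

Crux (route decl, FIXED): `Summit.RiemannHypothesis.RiemannHypothesis.Theses.SpectralTrace.WindowStep`
`= ∀ n ≥ 2, Trace(log n) → Trace(log (n+1))`, where `Trace(A)` says that some real unit-multiplicity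
family `γ` reproduces `W = weilFunctional` on the Weil tests supported in `[-A, A]`.

Source idea: `Cruxes/WindowStep/Ideas/ground-state-pinning.md` (ideator 4, round 2; triage r2: 2/2
PASS, "the one to lead" — TRIAGE-r2-1 sharpen (d) — but never planned into a line: the round-2 plan
seat went to the merged sibling `christoffel-margin`, whose quantitative cut `(U, PositiveLadder)` died
at `stub_unitMargin` (needs pinning = finite-height RH ∀ n; `Lines/christoffel-margin-dead.md`). This
file registers the QUALITATIVE cut (margin 0⁺ instead of two rungs), sharpened by both triage notes
and by what has landed since (the lower local Weyl law `card_near_ge_log_of_windowTrace`, p129023;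
kernel-certified `weilPositivityOn_log_three_half`).

## THE SITUATION (kernel-checked in the tree) and why this is not a 6th costume

`WindowStep ↔ (WindowTraceArch → RH)` (`Negative/Collapse.lean`, p83867). Hence EVERY honest line is
an exact conjunction with the RH content inside; the five dead lines each held it in ONE stub that
was `≡ RH` given the landed ones (`Sketch`: `stub_windowGrowth ≡ PositivityStep`, p88467;
`floor-feedback` ×2: `stub_quietLadder ≥ RH` and numerically false; `christoffel-margin`: `U ∧ PL`
with `U` needing finite-height RH uniformly in `n`). Here the RH content is CUT IN TWO along the one
axis the tree's PROVED structure of `ε(a) = weilGroundEnergy a` (continuous: Bombieri Thm 5,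
`continuousAt_weilGroundEnergy`; STRICTLY antitone: `weilGroundEnergy_lt_of_lt`; ground states
exist: `ConnesConsaniMoscovici2025_thm_3_6_holds`) makes available: in the counterfactual world
`WindowTraceArch ∧ ¬RH` let `a⋆` be the unique conjugate point (`ε(a⋆) = 0`) and
`A‡ := max {A : Trace(A)}` (a max by `TraceClosed` = stubs 1a+1b; `A‡ ≤ 2a⋆` since `Trace(A) ⇒ ε(A/2) ≥ 0`).
Then EXACTLY ONE of the two RH-bearing stubs fails:
* `stub_crystRegular` ("every level above the seed whose half level is REGULAR, `ε > 0`, is a rung")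
  fails iff `A‡ < 2a⋆` — the integer ladder dies with spectral slack left;
* `stub_coagulationDense` (v3; was `stub_coagulationExcluded`: "at a conjugate point no rung family
  coagulates onto the real zeros of the null ground state") fails iff `A‡ = 2a⋆` — the ladder dies
  exactly at the degenerate level.
Neither is `≡ RH`, neither is `≡ (Arch → RH)`, both are RH-implied (calibrations below, sorry-free),
both are crux-implied (so neither can be "stronger than RH and false", floor-feedback's death), and
they are of DIFFERENT mathematical type (synthesis-with-slack vs rigidity-at-degeneracy), each with
its own tools. The other three stubs are RH-free theorems-to-be.

## THE STUBS (5 registered; `sorry` lives only in `stub_*`)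

1. `TraceClosed` = `stub_traceLimit` + `stub_traceDilate` (RH-FREE, L+M): the set of levels carrying a trace family is closed under
   suprema: `(∀ B ∈ (0, A), Trace B) → Trace A`. Local compactness of point configurations along
   `B_k ↑ A` (uniform local counts from ONE positive test at level `B₁`, `card_near_le_log_uniform`;
   Bolzano–Weierstrass on the bounded sorted tuples of atoms in `[-R, R]`, or Mathlib's Prokhorov
   `isCompact_setOf_finiteMeasure_le_of_compactSpace`, diagonal in `R`), limits of integer-atomic
   configurations are integer-atomic, uniform tails by `‖ĝ(1/2+it)‖ ≤ C_g/(1+t²)`, then the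
   dilation `g(t/r)`, `r ↑ 1`, to reach tests supported in the CLOSED `[-A, A]` (W is continuous
   along the dilation: finite prime sum, polar term, archimedean integral; dominated convergence on
   the family side). NOTE: the tree's `windowCompactness_proof` went through RH (ladder ⇒ RH ⇒ zeros)
   and is NOT reusable here (only the levels `B < A` are rungs); this is the compactness argument the
   route card had planned for it, to be formalised from scratch.
2. `stub_groundStateSampling` (RH-FREE, M; the LEVER): a level-`2a` family is a unit-weight sampling
   measure of `Re Q` on `[-a, a]` (`hasSum_norm_sq_of_windowTrace`), and at the bottom eigenvector it
   gives `Σ_i |û(1/2+iγ_i)|² ≤ ε(a)` for every ground state `u` (Fatou along the minimising tests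
   that DEFINE `IsWeilGroundState`; `ĝ_n → û` uniformly on the line since `‖ĝ_n − û‖_∞ ≤ √(2a)‖g_n − u‖₂`).
3. `stub_gapLemma` (RH-FREE, L): a level-`2a` family of BOUNDED multiplicity is never contained in
   the zero set of a ground-state transform `û` (`û ≢ 0` entire of exponential type `≤ a`, bounded on
   the line ⇒ `O(1+R)` zeros in `[-R, R]` by Jensen; the family has `≥ (c log R − C)` atoms in every
   `R₀`-cell (`card_near_ge_log_of_windowTrace`, LANDED p129023), hence `≳ R log R / M` distinct
   atoms in `[-R, R]`).
4. `stub_coagulationSaturated` (v5 residual of v3 `stub_coagulationDense` / v1 `stub_coagulationExcluded`; RH-IMPLIED, OPEN; the EDGE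
   half): at a conjugate point `a ≥ log 3/2` (`ε(a) = 0`) no level-`2a` family whose multiplicities
   have upper log-density `≥ δ ∈ (0, 1/(2a)]` lies in the real zero set of a ground-state transform. (By 2+3 a degenerate rung family would have to: it is the "orthogonal
   crystal" of the critical Weil–de Branges space, multiplicities = the Christoffel values
   `λ_{2a}(x) ≍ log x/(2a)`, forced to be INTEGERS at all but finitely many real zeros of `û`.)
5. `stub_crystRegular` (RH-STRENGTH bet; the INTERIOR half): from the seed `WindowTraceArch`, every
   level `B ≥ log 2` with `0 < ε(B/2)` is a rung — integer synthesis WITH spectral slack (equal-weight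
   designs / unit-weight Parseval frames of real kernels in the regular Weil–de Branges space; finite
   toy: interior of the Carathéodory–Toeplitz cone ⇒ designs exist).

Composition (sorry-free): `noDegenerateEdge_of` (2+3+4 ⇒ `Trace(2a) → 0 < ε(a)` for `a ≥ log 3/2`;
below `log 3/2` it is a THEOREM from `weilPositivityOn_log_three_half` + strictness), then the IVT on
the proved continuous strictly antitone `ε` (`wtrace_above_of_rung`), then `WindowStep_of`.

## Disproof.lean (v2) honoured
§0 Collapse: made exact — `riemannHypothesis_of_stubs` shows the five stubs + `WindowTraceArch` give
RH, and `crystRegular_of_windowStep` / `coagulationDense_of_windowStep` show the two RH-bearing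
stubs are crux-IMPLIED (nothing held is stronger than the crux). §1 LoadBearing: (H1) `2 ≤ n` is used
as `0 < log n` and `log 2 ≤ log n` (the seed), (H2) the rung hypothesis is consumed through
`seed_of_rung` + the edge stub at `log n / 2`, (H3) conclusion window idle — consistent:
`wtrace_above_of_rung` yields every `B ≥ log n`. §2/§5 (`Nested`, `FiniteMoves`, `BothWays`,
`BelowHeight`): not engaged — no stub edits a given family (witness ↦ FORM ↦ witness); the edge
analysis is the extreme instance of BothWays (coagulation). §3 `EngineKill`: unused. No stub is an
instance of a landed Negative lemma (checked: UnitMass `norm_sq_le_of_windowTrace` is the kernel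
instance of the sampling identity, consistent with stub 2; LocalWeyl/RungCorridor feed stub 3).
-/

set_option linter.dupNamespace false

noncomputable section

open Complex Set Filter
open scoped Topology

namespace Summit.RiemannHypothesis.RiemannHypothesis.Cruxes.WindowStep.ConjugatePoint

open Literature.NumberTheory.LFunctions
open Summit.RiemannHypothesis.RiemannHypothesis.Theses.SpectralTrace
open Summit.RiemannHypothesis.RiemannHypothesis.Theorems
open Summit.RiemannHypothesis.RiemannHypothesis.Theorems.WindowStep.Negative
open Summit.RiemannHypothesis.RiemannHypothesis.Theorems.WeilWindowFlowGronwallLeakage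

/-- File-local spelling of `Trace(A)` (verbatim the shape of `WindowTraceArch` / `WindowStep`). -/
local notation3 "WTrace " A:max => ∃ (ι : Type) (γ : ι → ℝ), ∀ g : ℝ → ℂ, IsWeilTest g →
  tsupport g ⊆ Set.Icc (-A) A →
    HasSum (fun i => weilMellin g (1 / 2 + (γ i : ℂ) * I)) (weilFunctional g)

/-! ## Named statements of the line (each IS a registered stub, see `*_holds` below) -/

/-- Derived statement (RH-free; was stub 1, now proved from stubs 1a + 1b): closedness of the set
of trace levels under suprema. -/
def TraceClosed : Prop :=
  ∀ A : ℝ, 0 < A → (∀ B : ℝ, 0 < B → B < A → WTrace B) → WTrace A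

/-- Stub 1a statement (RH-free): from rung families at every level below `A`, ONE real family
serving every level below `A` (local compactness of rung configurations + identification). -/
def TraceLimit : Prop :=
  ∀ A : ℝ, 0 < A → (∀ B : ℝ, 0 < B → B < A → WTrace B) →
    ∃ (ι : Type) (γ : ι → ℝ), ∀ B : ℝ, 0 < B → B < A → ∀ g : ℝ → ℂ, IsWeilTest g →
      tsupport g ⊆ Set.Icc (-B) B →
        HasSum (fun i => weilMellin g (1 / 2 + (γ i : ℂ) * I)) (weilFunctional g)

/-- Stub 1b statement (RH-free): a family serving every level below `A` serves level `A`
(closure to the closed window by dilation). -/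
def TraceDilate : Prop :=
  ∀ A : ℝ, 0 < A → ∀ (ι : Type) (γ : ι → ℝ),
    (∀ B : ℝ, 0 < B → B < A → ∀ g : ℝ → ℂ, IsWeilTest g → tsupport g ⊆ Set.Icc (-B) B →
      HasSum (fun i => weilMellin g (1 / 2 + (γ i : ℂ) * I)) (weilFunctional g)) →
    ∀ g : ℝ → ℂ, IsWeilTest g → tsupport g ⊆ Set.Icc (-A) A →
      HasSum (fun i => weilMellin g (1 / 2 + (γ i : ℂ) * I)) (weilFunctional g)

/-- Stub 2 statement (RH-free; the lever): ground-state sampling from below. -/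
def GroundStateSampling : Prop :=
  ∀ a : ℝ, 0 < a → ∀ (ι : Type) (γ : ι → ℝ),
    (∀ g : ℝ → ℂ, IsWeilTest g → tsupport g ⊆ Set.Icc (-(2 * a)) (2 * a) →
      HasSum (fun i => weilMellin g (1 / 2 + (γ i : ℂ) * I)) (weilFunctional g)) →
    ∀ u : ℝ → ℂ, IsWeilGroundState a u →
      Summable (fun i => ‖weilMellin u (1 / 2 + (γ i : ℂ) * I)‖ ^ 2) ∧
        ∑' i, ‖weilMellin u (1 / 2 + (γ i : ℂ) * I)‖ ^ 2 ≤ weilGroundEnergy a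

/-- Stub 3 statement (RH-free): the gap lemma — a bounded-multiplicity level-`2a` family is not
contained in the zero set of a ground-state transform. -/
def GapLemma : Prop :=
  ∀ a : ℝ, 0 < a → ∀ u : ℝ → ℂ, IsWeilGroundState a u →
    ∀ (M : ℕ) (ι : Type) (γ : ι → ℝ), (∀ x : ℝ, {i : ι | γ i = x}.encard ≤ M) →
      (∀ g : ℝ → ℂ, IsWeilTest g → tsupport g ⊆ Set.Icc (-(2 * a)) (2 * a) →
        HasSum (fun i => weilMellin g (1 / 2 + (γ i : ℂ) * I)) (weilFunctional g)) →
      ∃ i : ι, weilMellin u (1 / 2 + (γ i : ℂ) * I) ≠ 0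

/-- Stub 4 statement, v3 (RH-implied, OPEN; the edge half of the dichotomy — the typed RESIDUAL
after the landed little-o lemma): at a conjugate point `a ≥ log 3 / 2` no level-`2a` family whose
multiplicities have POSITIVE UPPER LOGARITHMIC DENSITY (`δ · log|x| < #{i | γ i = x}` for
arbitrarily large `|x|`, for a `δ > 0`) lies in the real zero set of a ground-state transform
("no coagulated orthogonal crystal"). -/
def CoagulationDense : Prop :=
  ∀ a : ℝ, Real.log 3 / 2 ≤ a → weilGroundEnergy a = 0 → ∀ u : ℝ → ℂ, IsWeilGroundState a u →
    ∀ (ι : Type) (γ : ι → ℝ) (δ : ℝ), 0 < δ →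
      (∀ X : ℝ, ∃ x : ℝ, X ≤ |x| ∧ δ * Real.log |x| < ({i : ι | γ i = x}.ncard : ℝ)) →
      (∀ g : ℝ → ℂ, IsWeilTest g → tsupport g ⊆ Set.Icc (-(2 * a)) (2 * a) →
        HasSum (fun i => weilMellin g (1 / 2 + (γ i : ℂ) * I)) (weilFunctional g)) →
      ∃ i : ι, weilMellin u (1 / 2 + (γ i : ℂ) * I) ≠ 0

/-- Stub 4 statement, v5 (RH-implied, OPEN; the REGISTERED edge residual after the sharp cap): the
same as `CoagulationDense` with the density parameter confined to `0 < δ ≤ 1/(2a)` — the range the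
sharp Christoffel cap `ncard_fibre_le_sharp` (p142955) leaves open. -/
def CoagulationSaturated : Prop :=
  ∀ a : ℝ, Real.log 3 / 2 ≤ a → weilGroundEnergy a = 0 → ∀ u : ℝ → ℂ, IsWeilGroundState a u →
    ∀ (ι : Type) (γ : ι → ℝ) (δ : ℝ), 0 < δ → δ ≤ 1 / (2 * a) →
      (∀ X : ℝ, ∃ x : ℝ, X ≤ |x| ∧ δ * Real.log |x| < ({i : ι | γ i = x}.ncard : ℝ)) →
      (∀ g : ℝ → ℂ, IsWeilTest g → tsupport g ⊆ Set.Icc (-(2 * a)) (2 * a) →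
        HasSum (fun i => weilMellin g (1 / 2 + (γ i : ℂ) * I)) (weilFunctional g)) →
      ∃ i : ι, weilMellin u (1 / 2 + (γ i : ℂ) * I) ≠ 0

/-- Stub 5 statement (RH-strength; the interior half of the dichotomy): from the archimedean seed,
every level `B ≥ log 2` whose half level is REGULAR (`0 < ε(B/2)`) is a rung. -/
def CrystRegular : Prop :=
  ∀ B : ℝ, Real.log 2 ≤ B → WindowTraceArch → 0 < weilGroundEnergy (B / 2) → WTrace B

/-- The derived edge statement (NOT registered; proved below from stubs 2–4 and, below `log 3 / 2`,
from the tree): a rung level is never twice a conjugate point. -/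
def NoDegenerateEdge : Prop :=
  ∀ a : ℝ, 0 < a → (WTrace (2 * a)) → 0 < weilGroundEnergy a

/-! ## THE REGISTERED STUBS (genuine lemmas of the line; `sorry` only here) -/

/-- **stub_traceLimit (RH-FREE; stub 1a) — LANDED p138948** as
`Theorems/SpectralTraceWindowStepStubTraceLimit.lean` (levels `a_k ↑ A`, families chosen at each,
the tree's cell-wise ultrafilter selection `ClosedLadder.exists_limit_family`). From rung families at
every level below `A`, ONE real family serving EVERY level below `A`. -/
theorem stub_traceLimit :
    ∀ A : ℝ, 0 < A →
      (∀ B : ℝ, 0 < B → B < A →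
        ∃ (ι : Type) (γ : ι → ℝ), ∀ g : ℝ → ℂ, Literature.NumberTheory.LFunctions.IsWeilTest g →
          tsupport g ⊆ Set.Icc (-B) B →
            HasSum (fun i => Literature.NumberTheory.LFunctions.weilMellin g (1 / 2 + (γ i : ℂ) * Complex.I))
              (Literature.NumberTheory.LFunctions.weilFunctional g)) →
      ∃ (ι : Type) (γ : ι → ℝ), ∀ B : ℝ, 0 < B → B < A →
        ∀ g : ℝ → ℂ, Literature.NumberTheory.LFunctions.IsWeilTest g →
          tsupport g ⊆ Set.Icc (-B) B →
            HasSum (fun i => Literature.NumberTheory.LFunctions.weilMellin g (1 / 2 + (γ i : ℂ) * Complex.I))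
              (Literature.NumberTheory.LFunctions.weilFunctional g) :=
  Summit.RiemannHypothesis.RiemannHypothesis.Theorems.SpectralTraceWindowStep.stub_traceLimit

/-- **stub_traceDilate (RH-FREE; stub 1b) — LANDED p139078** as
`Theorems/SpectralTraceWindowStepStubTraceDilate.lean` (rescaling `g(c·)`, `c → 1⁺`; continuity of
`W` from `hasDerivAt_weilFunctional_comp_mul`; Tannery on the family). A real family serving every
level `B < A` serves the CLOSED level `A`. -/
theorem stub_traceDilate :
    ∀ A : ℝ, 0 < A → ∀ (ι : Type) (γ : ι → ℝ),
      (∀ B : ℝ, 0 < B → B < A →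
        ∀ g : ℝ → ℂ, Literature.NumberTheory.LFunctions.IsWeilTest g →
          tsupport g ⊆ Set.Icc (-B) B →
            HasSum (fun i => Literature.NumberTheory.LFunctions.weilMellin g (1 / 2 + (γ i : ℂ) * Complex.I))
              (Literature.NumberTheory.LFunctions.weilFunctional g)) →
      ∀ g : ℝ → ℂ, Literature.NumberTheory.LFunctions.IsWeilTest g →
        tsupport g ⊆ Set.Icc (-A) A →
          HasSum (fun i => Literature.NumberTheory.LFunctions.weilMellin g (1 / 2 + (γ i : ℂ) * Complex.I))
            (Literature.NumberTheory.LFunctions.weilFunctional g) :=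
  Summit.RiemannHypothesis.RiemannHypothesis.Theorems.SpectralTraceWindowStep.stub_traceDilate

/-- **stub_groundStateSampling (RH-FREE; stub 2, the lever) — LANDED p138965** as
`Theorems/SpectralTraceWindowStepStubGroundStateSampling.lean` (finite partial sums along the
minimising tests, `ConnesVanSuijlekom.tendsto_weilMellin`). A real family reproducing `W` on the Weil
tests of `[-2a, 2a]` samples every ground state of the window `a` from below:
`Σ_i ‖û(1/2+iγ_i)‖² ≤ ε(a)`. -/
theorem stub_groundStateSampling :
    ∀ a : ℝ, 0 < a → ∀ (ι : Type) (γ : ι → ℝ),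
      (∀ g : ℝ → ℂ, Literature.NumberTheory.LFunctions.IsWeilTest g →
        tsupport g ⊆ Set.Icc (-(2 * a)) (2 * a) →
          HasSum (fun i => Literature.NumberTheory.LFunctions.weilMellin g (1 / 2 + (γ i : ℂ) * Complex.I))
            (Literature.NumberTheory.LFunctions.weilFunctional g)) →
      ∀ u : ℝ → ℂ, Literature.NumberTheory.LFunctions.IsWeilGroundState a u →
        Summable (fun i => ‖Literature.NumberTheory.LFunctions.weilMellin u (1 / 2 + (γ i : ℂ) * Complex.I)‖ ^ 2) ∧
          ∑' i, ‖Literature.NumberTheory.LFunctions.weilMellin u (1 / 2 + (γ i : ℂ) * Complex.I)‖ ^ 2 ≤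
            Literature.NumberTheory.LFunctions.weilGroundEnergy a :=
  Summit.RiemannHypothesis.RiemannHypothesis.Theorems.SpectralTraceWindowStep.stub_groundStateSampling

/-- **stub_gapLemma (RH-FREE; stub 3) — LANDED p139126** as
`Theorems/SpectralTraceWindowStepStubGapLemma.lean` (Jensen count `exists_card_real_zeros_le` for
ground-state transforms vs the lower local Weyl law). A BOUNDED-multiplicity level-`2a` family is
not inside `Z(û)`. Superseded in the composition by the landed little-o lemma
`coagulation_excluded_of_mult_le_log`; kept as the landed record of the registered stub. -/
theorem stub_gapLemma :
    ∀ a : ℝ, 0 < a → ∀ u : ℝ → ℂ, Literature.NumberTheory.LFunctions.IsWeilGroundState a u →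
      ∀ (M : ℕ) (ι : Type) (γ : ι → ℝ), (∀ x : ℝ, {i : ι | γ i = x}.encard ≤ M) →
        (∀ g : ℝ → ℂ, Literature.NumberTheory.LFunctions.IsWeilTest g →
          tsupport g ⊆ Set.Icc (-(2 * a)) (2 * a) →
            HasSum (fun i => Literature.NumberTheory.LFunctions.weilMellin g (1 / 2 + (γ i : ℂ) * Complex.I))
              (Literature.NumberTheory.LFunctions.weilFunctional g)) →
        ∃ i : ι, Literature.NumberTheory.LFunctions.weilMellin u (1 / 2 + (γ i : ℂ) * Complex.I) ≠ 0 :=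
  Summit.RiemannHypothesis.RiemannHypothesis.Theorems.SpectralTraceWindowStep.stub_gapLemma

/-- **stub_coagulationSaturated (RH-IMPLIED, OPEN; stub 4 v5 — the EDGE half of the dichotomy,
exact typed residual after the sharp cap).** At a conjugate point `a ≥ log 3 / 2` (`ε(a) = 0`; at
most one by strict antitonicity, none `≤ a₁` for some `a₁ > log 3 / 2` by
`exists_gt_log_three_half_weilGroundEnergy_pos`), no real family reproducing `W` on the Weil tests of
`[-2a, 2a]` whose multiplicity function has upper logarithmic density `≥ δ` for some
`0 < δ ≤ 1/(2a)` (`∀ X, ∃ |x| ≥ X, δ log|x| < #{i | γ i = x}`) lies in the real zero set of a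
ground-state transform `û`. What is LANDED around it (all RH-free, every level, no `ε(a) = 0`
needed): `coagulation_excluded_of_mult_le_log` (multiplicities `≤ δ(a) log|x|` eventually ⇒
excluded, p139507/p139673/p139806); `ncard_fibre_le_sharp` (EVERY level-`2a` family has
`#{i | γ i = x} ≤ (1/(2a) + η) log|x|` eventually — so `δ > 1/(2a)` is vacuous,
`coagulationDense_of_inv_lt`, p142955); `saturatedAtoms_linear_density` (a violator's log-saturated
atoms — real zeros of `û` carrying `≥ κ(a) log|x|` indices — have linear density `≥ κ r`, p143295);
the Jensen count `exists_card_real_zeros_le_slope` (`≤ (2a/log 2) r + β` real zeros in `[-r, r]`).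
So a violator is the "orthogonal crystal": a set of real zeros of `û` of LINEAR growth, a positive
proportion log-saturated, every multiplicity `≤ (1+o(1)) log|x|/(2a)`; first-order counting is
exhausted (the sharp lower slope would need the Levinson–Cartwright real-zero density of `û`, and the
two sharp slopes balance EXACTLY); what is left is integrality of the Christoffel weights at a
conjugate level — second order, Diophantine. In the threshold model of `WindowTraceArch ∧ ¬RH` it fails
iff the integer ladder dies EXACTLY at the conjugate level (`A‡ = 2a⋆`); under RH vacuous
(`coagulationSaturated_of_riemannHypothesis`); crux-implied (`coagulationSaturated_of_windowStep`). -/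
theorem stub_coagulationSaturated :
    ∀ a : ℝ, Real.log 3 / 2 ≤ a → Literature.NumberTheory.LFunctions.weilGroundEnergy a = 0 →
      ∀ u : ℝ → ℂ, Literature.NumberTheory.LFunctions.IsWeilGroundState a u →
        ∀ (ι : Type) (γ : ι → ℝ) (δ : ℝ), 0 < δ → δ ≤ 1 / (2 * a) →
          (∀ X : ℝ, ∃ x : ℝ, X ≤ |x| ∧ δ * Real.log |x| < ({i : ι | γ i = x}.ncard : ℝ)) →
          (∀ g : ℝ → ℂ, Literature.NumberTheory.LFunctions.IsWeilTest g →
            tsupport g ⊆ Set.Icc (-(2 * a)) (2 * a) →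
              HasSum (fun i => Literature.NumberTheory.LFunctions.weilMellin g (1 / 2 + (γ i : ℂ) * Complex.I))
                (Literature.NumberTheory.LFunctions.weilFunctional g)) →
          ∃ i : ι, Literature.NumberTheory.LFunctions.weilMellin u (1 / 2 + (γ i : ℂ) * Complex.I) ≠ 0 := by
  sorry

/-- **The v3/v4 edge statement `CoagulationDense` DERIVED (v5)** from the registered residual and
the landed sharp cap: for `δ ≤ 1/(2a)` it is `stub_coagulationSaturated`, for `δ > 1/(2a)` it is
vacuous (`coagulationDense_of_inv_lt`, p142955). -/
theorem coagulationDense_of_saturated (hX : CoagulationSaturated) : CoagulationDense := by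
  intro a ha h0 u hu ι γ δ hδ hdense hγ
  have hapos : 0 < a := lt_of_lt_of_le (by positivity) ha
  by_cases hle : δ ≤ 1 / (2 * a)
  · exact hX a ha h0 u hu ι γ δ hδ hle hdense hγ
  · exact SpectralTraceWindowStep.coagulationDense_of_inv_lt a hapos u ι γ δ (lt_of_not_ge hle)
      hdense hγ

/-- **stub_crystRegular (RH-STRENGTH bet, HARDEST; the INTERIOR half of the dichotomy).** From the
archimedean seed `WindowTraceArch`, every window level `B ≥ log 2` whose half level is REGULAR for
Weil's form (`0 < ε(B/2)`: strictly before the conjugate point) carries a real unit-multiplicity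
trace family. Integer synthesis WITH spectral slack: at such `B` the completion of the tests on
`[-B/2, B/2]` under `Re Q` is a genuine de Branges space of entire functions of exponential type
`B/2`, and the claim is that it admits a unit-weight Parseval frame of real reproducing kernels
(finite shadow: interior of the Carathéodory–Toeplitz moment cone ⇒ equal-weight designs exist,
Seymour–Zaslavsky; infinite neighbours: Fourier frames, Ortega-Cerdà–Seip). Engines = those of the
sibling cruxes `WindowTraceArch` / `WindowTracePrime2` (far field free above the capacity height
`2πe^{B}` by frame synthesis; a finite bottom block closed by Newton–Kantorovich / compactness /
degree), none of which has to decide a SIGN here — the sign is the hypothesis `0 < ε(B/2)`. First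
contentful instance: `B = log 3` gives `WindowTracePrime2` from the seed with no side condition (v4:
`0 < ε((log 3)/2)` is a theorem, p141362; `crystRegular_first_instance_iff`). In the threshold model
of `WindowTraceArch ∧ ¬RH` this stub fails iff the integer ladder dies with slack (`A‡ < 2a⋆`);
RH-implied (`crystRegular_of_riemannHypothesis`); crux-implied (`crystRegular_of_windowStep`). The
Newman barrier bites QUANTITATIVELY (slack `ε` is astronomically small near `a⋆`), so the stub is
qualitative and its proof must use the STRUCTURE of the near-null directions, not the size of `ε`. -/
theorem stub_crystRegular :
    ∀ B : ℝ, Real.log 2 ≤ B →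
      Summit.RiemannHypothesis.RiemannHypothesis.Theses.SpectralTrace.WindowTraceArch →
      0 < Literature.NumberTheory.LFunctions.weilGroundEnergy (B / 2) →
        ∃ (ι : Type) (γ : ι → ℝ), ∀ g : ℝ → ℂ, Literature.NumberTheory.LFunctions.IsWeilTest g →
          tsupport g ⊆ Set.Icc (-B) B →
            HasSum (fun i => Literature.NumberTheory.LFunctions.weilMellin g (1 / 2 + (γ i : ℂ) * Complex.I))
              (Literature.NumberTheory.LFunctions.weilFunctional g) := by
  sorry

/-! ## Consistency: each named statement IS its registered stub (definitionally) -/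

theorem traceLimit_holds : TraceLimit := stub_traceLimit
theorem traceDilate_holds : TraceDilate := stub_traceDilate
theorem groundStateSampling_holds : GroundStateSampling := stub_groundStateSampling
theorem gapLemma_holds : GapLemma := stub_gapLemma
theorem coagulationSaturated_holds : CoagulationSaturated := stub_coagulationSaturated
theorem coagulationDense_holds : CoagulationDense := coagulationDense_of_saturated coagulationSaturated_holds
theorem crystRegular_holds : CrystRegular := stub_crystRegular

/-- `TraceClosed` from stubs 1a + 1b (pure logic). -/
theorem traceClosed_of (hL : TraceLimit) (hD : TraceDilate) : TraceClosed := by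
  intro A hA h
  obtain ⟨ι, γ, hγ⟩ := hL A hA h
  exact ⟨ι, γ, hD A hA ι γ hγ⟩

theorem traceClosed_holds : TraceClosed := traceClosed_of traceLimit_holds traceDilate_holds

/-! ## Name-keyed aliases (the hypotheses of the composition) -/
namespace Registered

/-- Alias of `TraceLimit` keyed by the registered stub name. -/
abbrev stub_traceLimit : Prop := TraceLimit
/-- Alias of `TraceDilate` keyed by the registered stub name. -/
abbrev stub_traceDilate : Prop := TraceDilate
/-- Alias of `GroundStateSampling` keyed by the registered stub name. -/
abbrev stub_groundStateSampling : Prop := GroundStateSampling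
/-- Alias of `GapLemma` keyed by the registered stub name. -/
abbrev stub_gapLemma : Prop := GapLemma
/-- Alias of `CoagulationSaturated` keyed by the registered stub name (v5). -/
abbrev stub_coagulationSaturated : Prop := CoagulationSaturated
/-- Alias of `CrystRegular` keyed by the registered stub name. -/
abbrev stub_crystRegular : Prop := CrystRegular

end Registered

/-! ## Kernel-checked glue (no `sorry` below this line) -/

/-- `GroundStateSampling` at a conjugate point: every atom of a level-`2a` family is a real zero of
every ground-state transform (a `tsum` of non-negative reals that is `≤ 0` vanishes termwise). -/
theorem groundStateVanishing (hS : GroundStateSampling) {a : ℝ} (ha : 0 < a)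
    (h0 : weilGroundEnergy a = 0) {ι : Type} {γ : ι → ℝ}
    (hγ : ∀ g : ℝ → ℂ, IsWeilTest g → tsupport g ⊆ Set.Icc (-(2 * a)) (2 * a) →
      HasSum (fun i => weilMellin g (1 / 2 + (γ i : ℂ) * I)) (weilFunctional g))
    {u : ℝ → ℂ} (hu : IsWeilGroundState a u) (i : ι) :
    weilMellin u (1 / 2 + (γ i : ℂ) * I) = 0 := by
  obtain ⟨hsum, hle⟩ := hS a ha ι γ hγ u hu
  rw [h0] at hle
  have hnn : ∀ j, 0 ≤ ‖weilMellin u (1 / 2 + (γ j : ℂ) * I)‖ ^ 2 := fun j => by positivity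
  have hi_le : ‖weilMellin u (1 / 2 + (γ i : ℂ) * I)‖ ^ 2 ≤
      ∑' j, ‖weilMellin u (1 / 2 + (γ j : ℂ) * I)‖ ^ 2 :=
    hsum.le_tsum i (fun j _ => hnn j)
  have hsq : ‖weilMellin u (1 / 2 + (γ i : ℂ) * I)‖ ^ 2 = 0 :=
    le_antisymm (hi_le.trans hle) (hnn i)
  exact norm_eq_zero.1 (sq_eq_zero_iff.1 hsq)

/-- Below Yoshida's certified rung there is no conjugate point: `0 < ε(a)` for `0 < a < log 3 / 2`
(kernel-certified `weilPositivityOn_log_three_half` + proved strict antitonicity). RH-free. -/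
theorem weilGroundEnergy_pos_of_lt_log_three_half {a : ℝ} (ha : 0 < a) (h : a < Real.log 3 / 2) :
    0 < weilGroundEnergy a :=
  weilGroundEnergy_pos_of_weilPositivityOn_of_lt weilPositivityOn_log_three_half ha h

/-- A level-`2a` family gives `0 ≤ ε(a)` (Bochner positivity on the half window,
`windowTraceToPositivity_proof`, then `weilGroundEnergy_nonneg_iff_holds`). RH-free. -/
theorem weilGroundEnergy_nonneg_of_wtrace {a : ℝ} (ha : 0 < a) (h : WTrace (2 * a)) :
    0 ≤ weilGroundEnergy a := by
  have hpos : WeilPositivityOn (2 * a / 2) := windowTraceToPositivity_proof (2 * a) h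
  rw [show 2 * a / 2 = a by ring] at hpos
  exact (weilGroundEnergy_nonneg_iff_holds ha).2 hpos

/-- **The edge statement from stub 2, the landed little-o lemma and stub 4** (and the tree below
`log 3 / 2`): a rung level is never twice a conjugate point. Case split: `a ≤ log 3 / 2` — theorem
(v4: closed ray, `weilGroundEnergy_pos_of_le_log_three_half`); else `ε(a) ≥ 0` by positivity, and if `ε(a) = 0` a ground state exists
(`ConnesConsaniMoscovici2025_thm_3_6_holds`), every atom is a zero of its transform
(`groundStateVanishing`); with `δ = δ(a)` of `coagulation_excluded_of_mult_le_log`, either the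
multiplicities are `≤ δ log|x|` eventually (contradicting that landed lemma) or they have upper
logarithmic density `≥ δ` (contradicting `CoagulationDense`). -/
theorem noDegenerateEdge_of (hS : GroundStateSampling) (hX : CoagulationDense) :
    NoDegenerateEdge := by
  intro a ha hr
  by_cases hle3 : a ≤ Real.log 3 / 2
  · -- v4: the CLOSED ray `a ≤ (log 3)/2` is a theorem (`0 < ε((log 3)/2)`, p141362)
    exact SpectralTraceWindowStep.weilGroundEnergy_pos_of_le_log_three_half ha hle3
  · have hge : Real.log 3 / 2 ≤ a := le_of_lt (lt_of_not_ge hle3)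
    have h0le : 0 ≤ weilGroundEnergy a := weilGroundEnergy_nonneg_of_wtrace ha hr
    rcases h0le.lt_or_eq with hpos | h0
    · exact hpos
    · exfalso
      have h0' : weilGroundEnergy a = 0 := h0.symm
      obtain ⟨u, hu⟩ :=
        ConnesConsaniMoscovici2025_thm_3_6_holds.exists_isWeilGroundState (a := a) ha
      obtain ⟨ι, γ, hγ⟩ := hr
      have hvan : ∀ i : ι, weilMellin u (1 / 2 + (γ i : ℂ) * I) = 0 :=
        fun i => groundStateVanishing hS ha h0' hγ hu i
      obtain ⟨δ, hδ, hlittle⟩ := SpectralTraceWindowStep.coagulation_excluded_of_mult_le_log a ha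
      by_cases hsub : ∃ X : ℝ, ∀ x : ℝ, X ≤ |x| → ({i : ι | γ i = x}.ncard : ℝ) ≤ δ * Real.log |x|
      · obtain ⟨i, hi⟩ := hlittle u hu ι γ hsub hγ
        exact hi (hvan i)
      · push Not at hsub
        obtain ⟨i, hi⟩ := hX a hge h0' u hu ι γ δ hδ hsub hγ
        exact hi (hvan i)

/-- **Child 2 of the route-level split from stubs 1–4.** The CLOSED-form edge statement
(`NoDegenerateEdge` as filed on the route by the strategist's split: "for `a ≥ log 3 / 2`, if every
level below `2a` is a rung then `0 < ε(a)`") follows from trace-closedness and the open form. Child 1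
of the split IS `stub_crystRegular` verbatim. -/
theorem noDegenerateEdgeClosed_of (hC : TraceClosed) (hS : GroundStateSampling)
    (hX : CoagulationDense) :
    ∀ a : ℝ, Real.log 3 / 2 ≤ a → (∀ B : ℝ, 0 < B → B < 2 * a → WTrace B) →
      0 < weilGroundEnergy a := by
  intro a ha h
  have hapos : 0 < a := lt_of_lt_of_le (by positivity) ha
  exact noDegenerateEdge_of hS hX a hapos (hC (2 * a) (by positivity) h)

/-- Continuity of `ε` on every compact range of positive windows (PROVED `continuousAt_weilGroundEnergy`,
Bombieri 2000 Thm 5). -/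
theorem continuousOn_weilGroundEnergy_Icc {a b : ℝ} (ha : 0 < a) :
    ContinuousOn weilGroundEnergy (Icc a b) := fun _ hx =>
  (continuousAt_weilGroundEnergy (ha.trans_le hx.1)).continuousWithinAt

/-- **CORE (the conjugate-point dichotomy, kernel-checked).** From closedness, regular synthesis and
the edge statement, a rung at `log n` (`n ≥ 2`) propagates to every level `B ≥ log n`. If `ε(B/2) > 0`
this is `CrystRegular` seeded by `seed_of_rung`. Otherwise the IVT (continuity, proved) puts a
conjugate point `c ∈ [log n / 2, B / 2]`; the edge statement at `log n / 2` makes the rung's own half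
level regular; strict antitonicity (proved) makes every level `< 2c` regular, hence a rung
(`CrystRegular` above `log 2`, `windowTrace_anti` below); `TraceClosed` makes `2c` a rung; and the edge
statement then says `0 < ε(c) = 0`. -/
theorem wtrace_above_of_rung (hC : TraceClosed) (hR : CrystRegular) (hE : NoDegenerateEdge)
    {n : ℕ} (hn : 2 ≤ n) (hrung : WTrace (Real.log (n : ℝ))) {B : ℝ} (hB : Real.log (n : ℝ) ≤ B) :
    WTrace B := by
  have hn' : (2 : ℝ) ≤ n := by exact_mod_cast hn
  have hlog2 : 0 < Real.log 2 := Real.log_pos one_lt_two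
  have hA₀ : 0 < Real.log (n : ℝ) := Real.log_pos (by linarith)
  have h2n : Real.log 2 ≤ Real.log (n : ℝ) := Real.log_le_log two_pos hn'
  -- the seed, from the rung (antitonicity): `WindowTraceArch` is definitionally `Trace(log 2)`
  have hArch : WindowTraceArch := seed_of_rung hn hrung
  by_cases hpos : 0 < weilGroundEnergy (B / 2)
  · exact hR B (h2n.trans hB) hArch hpos
  · exfalso
    have hposle : weilGroundEnergy (B / 2) ≤ 0 := le_of_not_gt hpos
    -- the rung certifies regularity at its own half level
    have h0 : 0 < weilGroundEnergy (Real.log (n : ℝ) / 2) := by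
      have h2 : WTrace (2 * (Real.log (n : ℝ) / 2)) := by
        rw [show 2 * (Real.log (n : ℝ) / 2) = Real.log (n : ℝ) by ring]
        exact hrung
      exact hE (Real.log (n : ℝ) / 2) (by positivity) h2
    -- a conjugate point between the two half levels
    have hle : Real.log (n : ℝ) / 2 ≤ B / 2 := by linarith
    have hcont : ContinuousOn weilGroundEnergy (Icc (Real.log (n : ℝ) / 2) (B / 2)) :=
      continuousOn_weilGroundEnergy_Icc (by positivity)
    obtain ⟨c, hc, hc0⟩ : ∃ c ∈ Icc (Real.log (n : ℝ) / 2) (B / 2), weilGroundEnergy c = 0 :=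
      intermediate_value_Icc' hle hcont ⟨hposle, h0.le⟩
    have hcpos : 0 < c := lt_of_lt_of_le (by positivity) hc.1
    -- every level below `2c` is a rung
    have hbelow : ∀ B' : ℝ, 0 < B' → B' < 2 * c → WTrace B' := by
      intro B' hB'pos hB'lt
      by_cases hcase : Real.log 2 ≤ B'
      · have hreg : 0 < weilGroundEnergy (B' / 2) := by
          have hlt : B' / 2 < c := by linarith
          have := weilGroundEnergy_lt_of_lt (a := B' / 2) (A := c) (by positivity) hlt
          linarith
        exact hR B' hcase hArch hreg
      · exact windowTrace_anti (le_of_not_ge hcase) hArch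
    -- closedness puts a rung AT `2c`, and the edge statement makes `c` regular: contradiction
    have htop : WTrace (2 * c) := hC (2 * c) (by positivity) hbelow
    have := hE c hcpos htop
    linarith

/-- **THE LINE CONCLUDES THE CRUX BY NAME** (pure logic over the registered stubs; no `sorry`
in this declaration). -/
theorem WindowStep_of (h₄ : Registered.stub_coagulationSaturated) (h₅ : Registered.stub_crystRegular) :
    Summit.RiemannHypothesis.RiemannHypothesis.Theses.SpectralTrace.WindowStep := by
  intro n hn hrung
  have hn' : (2 : ℝ) ≤ n := by exact_mod_cast hn
  have hB : Real.log (n : ℝ) ≤ Real.log ((n : ℝ) + 1) :=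
    Real.log_le_log (by linarith) (by linarith)
  -- stubs 1a, 1b, 2 are LANDED theorems (`traceLimit_holds`, `traceDilate_holds`,
  -- `groundStateSampling_holds` are sorry-free references to the tree); the edge statement is the
  -- registered residual `h₄` + the landed sharp cap (`coagulationDense_of_saturated`)
  exact wtrace_above_of_rung (traceClosed_of traceLimit_holds traceDilate_holds) h₅
    (noDegenerateEdge_of groundStateSampling_holds (coagulationDense_of_saturated h₄)) hn hrung hB

/-- Wiring check: the registered stubs feed `WindowStep_of` as stated (an `example`, so that no
sorry-tainted DECLARATION of this file has the crux as its type). -/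
example : Summit.RiemannHypothesis.RiemannHypothesis.Theses.SpectralTrace.WindowStep :=
  WindowStep_of stub_coagulationSaturated stub_crystRegular

/-! ## Calibration (sorry-free): honesty of the two RH-bearing stubs -/

/-- The interior stub is RH-IMPLIED (the zero ordinates serve every level). -/
theorem crystRegular_of_riemannHypothesis (hRH : _root_.RiemannHypothesis) : CrystRegular :=
  fun B _ _ _ => windowTrace_of_riemannHypothesis hRH B

/-- The edge stub is RH-IMPLIED — in fact vacuous under RH: `ε(a) > 0` at every window (positivity at
`a + 1` and strict antitonicity), so no conjugate point exists. -/
theorem coagulationDense_of_riemannHypothesis (hRH : _root_.RiemannHypothesis) :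
    CoagulationDense := by
  intro a ha h0
  exfalso
  have hapos : 0 < a := lt_of_lt_of_le (by positivity) ha
  have hpos : WeilPositivityOn (a + 1) :=
    WeilPositivityOn.of_riemannHypothesis explicit_formula_holds hRH (a + 1)
  have := weilGroundEnergy_pos_of_weilPositivityOn_of_lt hpos hapos (by linarith)
  linarith

/-- The v5 edge residual is RH-IMPLIED (it is implied by `CoagulationDense`, vacuous under RH). -/
theorem coagulationSaturated_of_coagulationDense (h : CoagulationDense) : CoagulationSaturated :=
  fun a ha h0 u hu ι γ δ hδ _ hdense hγ => h a ha h0 u hu ι γ δ hδ hdense hγ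

/-- The v5 edge residual is RH-IMPLIED. -/
theorem coagulationSaturated_of_riemannHypothesis (hRH : _root_.RiemannHypothesis) :
    CoagulationSaturated :=
  coagulationSaturated_of_coagulationDense (coagulationDense_of_riemannHypothesis hRH)

/-- The interior stub is CRUX-IMPLIED (so it cannot be "stronger than RH and false"): under the crux,
the seed gives RH (Collapse), hence every level. -/
theorem crystRegular_of_windowStep (hStep : WindowStep) : CrystRegular :=
  fun B _ hArch _ =>
    windowTrace_of_riemannHypothesis (riemannHypothesis_of_windowTraceArch_of_windowStep hArch hStep) B

/-- The edge stub is CRUX-IMPLIED: a rung at level `2a ≥ log 3 > log 2` contains the seed, so under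
the crux RH holds and no conjugate point exists. -/
theorem coagulationDense_of_windowStep (hStep : WindowStep) : CoagulationDense := by
  intro a ha h0 u hu ι γ _ _ _ hγ
  exfalso
  have hlog3 : Real.log 2 ≤ Real.log 3 := Real.log_le_log two_pos (by norm_num)
  have h2a : Real.log 2 ≤ 2 * a := by linarith
  have hArch : WindowTraceArch := windowTrace_anti h2a ⟨ι, γ, hγ⟩
  have hRH := riemannHypothesis_of_windowTraceArch_of_windowStep hArch hStep
  have hapos : 0 < a := lt_of_lt_of_le (by positivity) ha
  have hpos : WeilPositivityOn (a + 1) :=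
    WeilPositivityOn.of_riemannHypothesis explicit_formula_holds hRH (a + 1)
  have := weilGroundEnergy_pos_of_weilPositivityOn_of_lt hpos hapos (by linarith)
  linarith

/-- The v5 edge residual is CRUX-IMPLIED. -/
theorem coagulationSaturated_of_windowStep (hStep : WindowStep) : CoagulationSaturated :=
  coagulationSaturated_of_coagulationDense (coagulationDense_of_windowStep hStep)

/-- Honest accounting (Collapse made exact): the six stubs turn the SEED into RH. So the pair
(`stub_coagulationSaturated`, `stub_crystRegular`) is jointly worth `WindowTraceArch → RH` given the
three RH-free stubs — and by the threshold analysis in the module docstring neither alone is. -/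
theorem riemannHypothesis_of_stubs (h₁ : TraceLimit) (h₁' : TraceDilate) (h₂ : GroundStateSampling)
    (h₄ : CoagulationDense) (h₅ : CrystRegular) (hArch : WindowTraceArch) :
    _root_.RiemannHypothesis := by
  have hStep : WindowStep := by
    intro n hn hrung
    have hn' : (2 : ℝ) ≤ n := by exact_mod_cast hn
    have hB : Real.log (n : ℝ) ≤ Real.log ((n : ℝ) + 1) :=
      Real.log_le_log (by linarith) (by linarith)
    exact wtrace_above_of_rung (traceClosed_of h₁ h₁') h₅ (noDegenerateEdge_of h₂ h₄) hn hrung hB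
  exact riemannHypothesis_of_windowTraceArch_of_windowStep hArch hStep

/-- By-product for the sibling crux (TRIAGE-r2-2), v4 UNCONDITIONAL: the FIRST arithmetic step
needs no edge stub and no `TraceClosed`: `CrystRegular` gives `WindowTracePrime2` from the seed,
because `0 < ε((log 3)/2)` is a theorem (`weilGroundEnergy_log_three_half_pos`, p141362). -/
theorem windowTracePrime2_of_crystRegular (hR : CrystRegular) (hArch : WindowTraceArch) :
    WindowTracePrime2 :=
  hR (Real.log 3) (Real.log_le_log two_pos (by norm_num)) hArch
    SpectralTraceWindowStep.weilGroundEnergy_log_three_half_pos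

/-- **The held stub's first instance IS the sibling crux (exact, v4).** `CrystRegular` restricted to
the levels `B ∈ [log 2, log 3]` is EQUIVALENT to `WindowTraceArch → WindowTracePrime2`: (→) at
`B = log 3` by `0 < ε((log 3)/2)`; (←) a rung at `log 3` serves every `B ≤ log 3` (`windowTrace_anti`).
So any proof of `stub_crystRegular` proves the sibling crux item `WindowTracePrime2` from the seed,
and conversely the sibling crux closes the stub on its first octave `[log 2, log 3]`; what lies
beyond (`B > log 3`: the prime powers `3, 4, 5, …` entering one by one) is the rest of the ladder. -/
theorem crystRegular_first_instance_iff :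
    (∀ B : ℝ, Real.log 2 ≤ B → B ≤ Real.log 3 → WindowTraceArch →
        0 < weilGroundEnergy (B / 2) → WTrace B) ↔
      (WindowTraceArch → WindowTracePrime2) := by
  constructor
  · intro h hArch
    exact h (Real.log 3) (Real.log_le_log two_pos (by norm_num)) le_rfl hArch
      SpectralTraceWindowStep.weilGroundEnergy_log_three_half_pos
  · intro h B _ hB3 hArch _
    exact windowTrace_anti hB3 (h hArch)

/-- `CrystRegular` splits EXACTLY into its first octave (= the sibling crux from the seed) and the
levels above `log 3`. -/
theorem crystRegular_iff_prime2_and_above :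
    CrystRegular ↔
      ((WindowTraceArch → WindowTracePrime2) ∧
        ∀ B : ℝ, Real.log 3 < B → WindowTraceArch → 0 < weilGroundEnergy (B / 2) → WTrace B) := by
  constructor
  · intro hR
    exact ⟨windowTracePrime2_of_crystRegular hR, fun B hB hArch hε =>
      hR B ((Real.log_le_log two_pos (by norm_num : (2 : ℝ) ≤ 3)).trans hB.le) hArch hε⟩
  · rintro ⟨hP, hA⟩ B h2 hArch hε
    by_cases hB3 : B ≤ Real.log 3
    · exact windowTrace_anti hB3 (hP hArch)
    · exact hA B (lt_of_not_ge hB3) hArch hε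

end Summit.RiemannHypothesis.RiemannHypothesis.Cruxes.WindowStep.ConjugatePoint

end
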